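import Summits.BirchSwinnertonDyer.Rank1Residual.X4.KuriharaLevelLoweringOfMultiplicityOne
import Literature.NumberTheory.EllipticCurves.PAdicLFunctionMinusIntegralityProofs
import HarnessLib

/-!
# The level-lowering certificate from (MO) + (OLD): the MINUS symbol (odd twists `χ_D`, `D < 0`) (cell `b2b-bsdres`, seat additive-p4 gen 23, line V42, file K5)

HONEST FRAMING (verbatim, cell `b2b-bsdres`): the goal of the cell is to DELETE the COMBINATION-SHAPED
residual classes for ALL analytic-rank `≤ 1` curves over `ℚ` — "full BSD formula for every rank `≤ 1`
curve in class `C`" assembled STRICTLY from published theorems — so that the rank-`≤ 1` remainder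
becomes exactly the CONSTRUCTION-SHAPED classes, which are TYPED (missing-input Props), NOT attempted;
this is not "finishing BSD". This file: research-route KERNEL REDUCTION, the minus-sign twin of
`X4/KuriharaLevelLoweringOfMultiplicityOne.lean`; the displayed hypotheses are predicates WITH
PARAMETERS, not named facts; nothing booked; X4 stays CONSTRUCTION-SHAPED.

## Why (census of gen 23, `V42-SUBPARTITION-*.tsv`)

When the cell's additive `W` is read on a quadratic twist by an ODD character (`D < 0`: 10 of the 39
twist-good TAM-DEFECT₂ unit cells at `p ≥ 5`, and 381 of 463 at `p = 3` where `D = −3` dominates), the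
`V`-side function entering the transport is the MINUS symbol `[r]⁻_{f₀}`
(`X4/KuriharaLevelLoweringTwistMinus.lean`, `Additive/X4QuadraticTwistCertificate.lean` `…_of_neg`). So
the two published inputs must be displayed on the `θ̄`-eigen MINUS subspace
(`Φ|ι = −Φ`) of `Symb_{Γ₀(N)}(Sym⁰ k)`:

* §1 the tree's rational minus symbol `r ↦ [r]⁻_f` as an element of `Symb_{Γ₀(N)}(Sym⁰ ℚ)`, Hecke-eigen
  at every prime, anti-invariant under `ι` (`potSymbOf_ratMinusSymbol_mem_Symb`,
  `hecke_potSymbOf_ratMinusSymbol`, `slash_iota_potSymbOf_ratMinusSymbol`) — from the tree's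
  `minusPart (clSymb f)`, `ratMinusSymbol_mul_minusPeriod_mul_I`, `ratMinusSymbol_neg`;
* §2 the predicates **(MO⁻) `ModPMultiplicityOneMinus k N θ`** and **(OLD⁻) `HasOldEigenMinusSymb k N θ ℓ w μ`**
  (same print provenance as the plus case: Mazur / Ribet 1990 Thm. 5.2 (b) / Wiles 1995 Thm. 2.1 read on
  the `−` eigenspace of complex conjugation; Ribet 1990 Thm. 1.1 + Ihara for the old line);
* §3 `isEigenMinusSymb_redMinusSymb` (PROVED: `f`'s reduced minus symbol lies in the subspace),
  `exists_ratMinusSymbol_eq_mul_oldShape_of_multiplicityOneMinus` (**`[r]⁻_f ≡ c·(μ(r) − w μ(ℓ r))`**),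
  `exists_oldShapeMinus_of_multiplicityOne_twist` — the `V`-side input `hV` (`Φ = ratMinusSymbol f₀`)
  of gen 23's `plusSymbolLevelLowersOver_of_jacobiTwistFn`.

## References

* K. A. Ribet, Invent. Math. 100 (1990), Thm. 1.1, Thm. 5.2 (b). [cite: Ribet1990, Thm. 1.1 and Thm. 5.2 (b)]
* A. Wiles, Ann. of Math. 141 (1995), Thm. 2.1. [cite: Wiles1995, Thm. 2.1]
* B. Mazur, J. Tate, J. Teitelbaum, Invent. Math. 84 (1986), §I.4 (4.2), §I.8. [cite: MazurTateTeitelbaum1986Invent, §I.4 (4.2) and §I.8]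
* C.-H. Kim, Amer. J. Math. 148 (2026), §1.2.2, §1.4.3. [cite: Kim2022StructureSelmer, §1.2.2 and §1.4.3]
-/

noncomputable section

open scoped MatrixGroups ModularForm

open CongruenceSubgroup Finset Matrix

open Literature.NumberTheory.EllipticCurves Literature.NumberTheory.EllipticCurves.ModularForms
  Literature.NumberTheory.EllipticCurves.ModularForms.HidaCohomology

namespace Summit.BirchSwinnertonDyer.Rank1Residual.LevelLowering

variable {k : Type*} [CommRing k]

/-- The potential of `g ∘ φ` is `g` of the potential of `φ` when `g 0 = 0`. [folklore] -/
theorem potOf_map {R R' : Type*} [CommRing R] [CommRing R'] (g : R → R') (hg : g 0 = 0) (φ : ℚ → R)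
    (x : P1Q) : potOf (fun r ↦ g (φ r)) x = g (potOf φ x) := by
  rcases P1Q.infty_or_ofRat x with rfl | ⟨r, rfl⟩
  · rw [potOf_infty, potOf_infty, hg]
  · rw [potOf_ofRat, potOf_ofRat]

/-! ### §1 The rational minus symbol as an element of `Symb_{Γ₀(N)}(Sym⁰ ℚ)` -/

section RationalMinus

variable {N : ℕ} (f : CuspForm (Gamma0 N) 2)

/-- `potOf [·]⁻_f (ι x) = − potOf [·]⁻_f x` (`[−r]⁻ = −[r]⁻`). [cite: MazurTateTeitelbaum1986Invent, §I.8] -/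
theorem potOf_ratMinusSymbol_act_iotaMat (x : P1Q) :
    potOf (ratMinusSymbol f) (P1Q.act iotaMat x) = -potOf (ratMinusSymbol f) x := by
  rcases P1Q.infty_or_ofRat x with rfl | ⟨r, rfl⟩
  · rw [P1Q.act_iotaMat_infty, potOf_infty, neg_zero]
  · rw [P1Q.act_iotaMat_ofRat, potOf_ofRat, potOf_ofRat, ratMinusSymbol_neg]

/-- **The minus symbol is ANTI-invariant under `ι`**: `Φ⁻|ι = −Φ⁻` for `Φ⁻ = potSymbOf [·]⁻_f`.
[cite: MazurTateTeitelbaum1986Invent, §I.8] -/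
theorem slash_iota_potSymbOf_ratMinusSymbol (S : Set (Matrix (Fin 2) (Fin 2) ℤ)) :
    (CoeffActionOn.symPowOn S 0 ℚ).slash iotaMat (potSymbOf (ratMinusSymbol f)) =
      -potSymbOf (ratMinusSymbol f) := by
  funext x y i
  rw [symPowOn_zero_slash, Pi.neg_apply, Pi.neg_apply, Pi.neg_apply, potSymbOf_apply, potSymbOf_apply,
    potOf_ratMinusSymbol_act_iotaMat, potOf_ratMinusSymbol_act_iotaMat]
  ring

variable [NeZero N]

/-- `([x]⁻ : ℂ) · Ω⁻_f · i = (msPot f x − msPot f (ι x))/2` for a rational newform.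
[cite: MazurTateTeitelbaum1986Invent, §I.8] -/
theorem ratCast_potOf_ratMinusSymbol_mul (hf : IsNewform0 f) (hQ : coeffField f = ⊥) (x : P1Q) :
    ((potOf (ratMinusSymbol f) x : ℚ) : ℂ) * (minusPeriod f : ℂ) * Complex.I =
      (msPot f x - msPot f (P1Q.act iotaMat x)) / 2 := by
  rcases P1Q.infty_or_ofRat x with rfl | ⟨r, rfl⟩
  · rw [potOf_infty, P1Q.act_iotaMat_infty, msPot_infty, Rat.cast_zero, zero_mul, zero_mul, sub_zero,
      zero_div]
  · rw [potOf_ofRat, P1Q.act_iotaMat_ofRat, msPot_ofRat, msPot_ofRat,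
      ratMinusSymbol_mul_minusPeriod_mul_I f hf hQ r, minusSymbol]

/-- **`potSymbOf [·]⁻_f` cast to `ℂ` is `(2Ω⁻ i)⁻¹ · ({x,y}_f)⁻`.** [cite: MazurTateTeitelbaum1986Invent, §I.8] -/
theorem mapZero_potSymbOf_ratMinusSymbol (S : Set (Matrix (Fin 2) (Fin 2) ℤ)) (hf : IsNewform0 f)
    (hQ : coeffField f = ⊥) (hΩ : minusPeriod f ≠ 0) :
    mapZero (Rat.castHom ℂ) (potSymbOf (ratMinusSymbol f)) =
      ((2 * (minusPeriod f : ℂ) * Complex.I)⁻¹) • (CoeffActionOn.symPowOn S 0 ℂ).minusPart (clSymb f) := by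
  have hΩ' : (minusPeriod f : ℂ) ≠ 0 := by exact_mod_cast hΩ
  have hc : (2 * (minusPeriod f : ℂ) * Complex.I) ≠ 0 :=
    mul_ne_zero (mul_ne_zero two_ne_zero hΩ') Complex.I_ne_zero
  funext x y i
  rw [mapZero_apply, potSymbOf_apply, Pi.smul_apply, Pi.smul_apply, Pi.smul_apply,
    CoeffActionOn.minusPart, Pi.sub_apply, Pi.sub_apply, Pi.sub_apply, symPowOn_zero_slash,
    clSymb_apply, clSymb_apply, smul_eq_mul, Rat.coe_castHom, Rat.cast_sub]
  have hy := ratCast_potOf_ratMinusSymbol_mul f hf hQ y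
  have hx := ratCast_potOf_ratMinusSymbol_mul f hf hQ x
  rw [eq_inv_mul_iff_mul_eq₀ hc]
  linear_combination (2 : ℂ) * hy - (2 : ℂ) * hx

/-- **`[y]⁻ − [x]⁻ ∈ Symb_{Γ₀(N)}(Sym⁰ ℚ)`.** [cite: MazurTateTeitelbaum1986Invent, §I.8] -/
theorem potSymbOf_ratMinusSymbol_mem_Symb (hf : IsNewform0 f) (hQ : coeffField f = ⊥)
    (hΩ : minusPeriod f ≠ 0) :
    potSymbOf (ratMinusSymbol f) ∈ (CoeffActionOn.symPowOn (sigma0Set N) 0 ℚ).Symb (Gamma0 N) := by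
  rw [← mapZero_mem_Symb_iff (σ := Rat.castHom ℂ) (Rat.castHom ℂ).injective,
    mapZero_potSymbOf_ratMinusSymbol f (sigma0Set N) hf hQ hΩ]
  exact Submodule.smul_mem _ _ ((CoeffActionOn.symPowOn (sigma0Set N) 0 ℂ).minusPart_mem_Symb
    (iotaMat_mem_sigma0Set N) (fun γ hγ ↦ coe_mem_sigma0Set' γ hγ) (clSymb_mem_Symb f (sigma0Set N)))

/-- **`T_q ([y]⁻ − [x]⁻) = a_q ([y]⁻ − [x]⁻)`** (every prime `q`; `T_q` or `U_q`) with `a_q = a_q(f) ∈ ℚ`.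
[cite: MazurTateTeitelbaum1986Invent, §I.8] -/
theorem hecke_potSymbOf_ratMinusSymbol (hf : IsNewform0 f) (hQ : coeffField f = ⊥)
    (hΩ : minusPeriod f ≠ 0) {q : ℕ} [Fact q.Prime] {aq : ℚ} (haq : (aq : ℂ) = cuspCoeff f q) :
    (CoeffActionOn.symPowOn (sigma0Set N) 0 ℚ).hecke N q (potSymbOf (ratMinusSymbol f)) =
      aq • potSymbOf (ratMinusSymbol f) := by
  haveI : NeZero q := ⟨(Fact.out : q.Prime).ne_zero⟩
  rw [← hecke_mapZero_eq_smul_iff (σ := Rat.castHom ℂ) (Rat.castHom ℂ).injective,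
    mapZero_potSymbOf_ratMinusSymbol f (sigma0Set N) hf hQ hΩ, map_smul, Rat.coe_castHom, haq, smul_comm]
  congr 1
  have heig : heckeT (Gamma0 N) 2 q f = cuspCoeff f q • f := hf.heckeT_eq_coeff_smul Fact.out
  exact (CoeffActionOn.symPowOn (sigma0Set N) 0 ℂ).hecke_minusPart (sigma0Set_mulClosed N)
    (Fact.out : q.Prime).ne_zero (iotaMat_mem_sigma0Set N) (fun γ hγ ↦ coe_mem_sigma0Set' γ hγ)
    (fun i ↦ heckeRep_mem_sigma0Set Fact.out i) (clSymb_mem_Symb f (sigma0Set N))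
    (hecke_clSymb_of_eigen f (sigma0Set N) heig)

end RationalMinus

/-! ### §2 The eigen-MINUS subspace and the two displayed hypotheses -/

section Predicates

variable (k) in
/-- **The `θ`-eigen, `ι`-ANTI-fixed subspace of `Symb_{Γ₀(N)}(Sym⁰ k)`** (`Φ|ι = −Φ`, the minus part):
twin of `IsEigenPlusSymb`. A predicate; nothing asserted. [cite: Ribet1990, Thm. 5.2 (b)] [cite: Wiles1995, Thm. 2.1] -/
def IsEigenMinusSymb (N : ℕ) (θ : ℕ → k) (Φ : P1Q → P1Q → (Fin 1 → k)) : Prop :=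
  Φ ∈ (CoeffActionOn.symPowOn (sigma0Set N) 0 k).Symb (Gamma0 N) ∧
    (∀ (q : ℕ) [NeZero q], q.Prime → (CoeffActionOn.symPowOn (sigma0Set N) 0 k).hecke N q Φ = θ q • Φ) ∧
    (CoeffActionOn.symPowOn (sigma0Set N) 0 k).slash iotaMat Φ = -Φ

variable (k) in
/-- **(MO⁻) mod-`p` MULTIPLICITY ONE for the `θ`-eigen MINUS symbols of level `N`**: dimension `≤ 1`.
IN PRINT (for `k ⊇ 𝔽_p`, `θ = θ̄_f`, `ρ̄_f` absolutely irreducible) when `p ∤ 2N` — the `−1`-eigenspace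
of complex conjugation in `J₀(N)[𝔪] ≅ ρ̄_𝔪` (Mazur 1977; Ribet 1990 Thm. 5.2 (b); Mazur–Ribet; Wiles
1995 Thm. 2.1), with the same `p = 3` rider as the plus case; NOT IN PRINT when `p² ∣ N`. A predicate
(typed target); nothing asserted. [cite: Ribet1990, Thm. 5.2 (b)] [cite: Wiles1995, Thm. 2.1] -/
def ModPMultiplicityOneMinus (N : ℕ) (θ : ℕ → k) : Prop :=
  ∀ Φ Ψ : P1Q → P1Q → (Fin 1 → k), IsEigenMinusSymb k N θ Φ → IsEigenMinusSymb k N θ Ψ → Ψ ≠ 0 →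
    ∃ c : k, Φ = c • Ψ

variable (k) in
/-- **(OLD⁻) a NON-ZERO `ℓ`-OLD eigen-MINUS symbol with eigensystem `θ`**: the symbol of
`r ↦ μ(r) − w·μ(ℓ r)` lies in `IsEigenMinusSymb k N θ` and is non-zero. Same print provenance as
`HasOldEigenPlusSymb` (Ribet 1990 Thm. 1.1 / Diamond 1995 + stabilisation + Edixhoven 1992 + Ihara),
read on the minus symbol of the old eigenvector. A predicate (typed target); nothing asserted.
[cite: Ribet1990, Thm. 1.1] [cite: Diamond1995RefinedSerre, Thm. 1.1] [cite: Ribet1984ICM, Thm. 4.1] -/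
def HasOldEigenMinusSymb (N : ℕ) (θ : ℕ → k) (ℓ : ℕ) (w : k) (μ : ℚ → k) : Prop :=
  IsEigenMinusSymb k N θ (potSymbOf fun r ↦ μ r - w * μ (ℓ * r)) ∧
    potSymbOf (fun r ↦ μ r - w * μ (ℓ * r)) ≠ 0

end Predicates

/-! ### §3 `f`'s reduced MINUS symbol lies in the subspace; the old shape from (MO⁻) + (OLD⁻) -/

section Reduction

variable {p : ℕ} [hp : Fact p.Prime] {ι : ZMod p →+* k} {N : ℕ} [NeZero N] {f : CuspForm (Gamma0 N) 2}

/-- Casting a difference of `p`-integral rationals to `ℤ/p`. [folklore] -/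
private theorem ratCast_sub_of_not_dvdM {a b : ℚ} (ha : ¬ p ∣ a.den) (hb : ¬ p ∣ b.den) :
    ((a - b : ℚ) : ZMod p) = (a : ZMod p) - (b : ZMod p) := by
  have ha' : (a.den : ZMod p) ≠ 0 := by rwa [Ne, ZMod.natCast_eq_zero_iff]
  have hb' : (b.den : ZMod p) ≠ 0 := by rwa [Ne, ZMod.natCast_eq_zero_iff]
  exact Rat.cast_sub_of_ne_zero ha' hb'

/-- Casting an integer multiple of a `p`-integral rational to `ℤ/p`. [folklore] -/
private theorem ratCast_intCast_mul_of_not_dvdM (n : ℤ) {a : ℚ} (ha : ¬ p ∣ a.den) :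
    (((n : ℚ) * a : ℚ) : ZMod p) = (n : ZMod p) * (a : ZMod p) := by
  have ha' : (a.den : ZMod p) ≠ 0 := by rwa [Ne, ZMod.natCast_eq_zero_iff]
  have hn' : ((n : ℚ).den : ZMod p) ≠ 0 := by rw [Rat.den_intCast, Nat.cast_one]; exact one_ne_zero
  rw [Rat.cast_mul_of_ne_zero hn' ha', Rat.cast_intCast]

/-- The denominator of a sum of `p`-integral rationals is prime to `p`. [folklore] -/
private theorem not_dvd_den_addM {a b : ℚ} (ha : ¬ p ∣ a.den) (hb : ¬ p ∣ b.den) :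
    ¬ p ∣ (a + b).den := by
  intro h
  rcases (Nat.Prime.dvd_mul hp.out).mp (dvd_trans h (Rat.add_den_dvd a b)) with h1 | h2
  · exact ha h1
  · exact hb h2

/-- The denominator of a difference of `p`-integral rationals is prime to `p`. [folklore] -/
private theorem not_dvd_den_subM {a b : ℚ} (ha : ¬ p ∣ a.den) (hb : ¬ p ∣ b.den) :
    ¬ p ∣ (a - b).den := by
  rw [sub_eq_add_neg]
  exact not_dvd_den_addM ha (by rwa [Rat.den_neg_eq_den])

/-- The denominator of a finite sum of `p`-integral rationals is prime to `p`. [folklore] -/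
private theorem not_dvd_den_sumM {α : Type*} (s : Finset α) (g : α → ℚ)
    (hg : ∀ i ∈ s, ¬ p ∣ (g i).den) : ¬ p ∣ (∑ i ∈ s, g i).den := by
  classical
  induction s using Finset.induction_on with
  | empty =>
    rw [Finset.sum_empty, Rat.den_zero]
    exact fun h ↦ hp.out.one_lt.ne' (Nat.dvd_one.mp h)
  | @insert a s has ih =>
    rw [Finset.sum_insert has]
    exact not_dvd_den_addM (hg a (Finset.mem_insert_self a s))
      (ih fun i hi ↦ hg i (Finset.mem_insert_of_mem hi))

/-- Casting a `p`-integral finite sum to `ℤ/p`. [folklore] -/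
private theorem ratCast_sum_of_not_dvdM {α : Type*} (s : Finset α) (g : α → ℚ)
    (hg : ∀ i ∈ s, ¬ p ∣ (g i).den) :
    ((∑ i ∈ s, g i : ℚ) : ZMod p) = ∑ i ∈ s, ((g i : ℚ) : ZMod p) := by
  classical
  induction s using Finset.induction_on with
  | empty => simp
  | @insert a s has ih =>
    have hs : ∀ i ∈ s, ¬ p ∣ (g i).den := fun i hi ↦ hg i (Finset.mem_insert_of_mem hi)
    have hga : ((g a).den : ZMod p) ≠ 0 := by
      rw [Ne, ZMod.natCast_eq_zero_iff]; exact hg a (Finset.mem_insert_self a s)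
    have hsum : ((∑ i ∈ s, g i).den : ZMod p) ≠ 0 := by
      rw [Ne, ZMod.natCast_eq_zero_iff]; exact not_dvd_den_sumM s g hs
    rw [Finset.sum_insert has, Finset.sum_insert has, Rat.cast_add_of_ne_zero hga hsum, ih hs]

omit [NeZero N] in
/-- The potential of `[·]⁻_f` is `p`-integral when every `[r]⁻_f` is. [folklore] -/
private theorem not_dvd_den_potOf_minus (hint : ∀ r : ℚ, ¬ p ∣ (ratMinusSymbol f r).den) (x : P1Q) :
    ¬ p ∣ (potOf (ratMinusSymbol f) x).den := by
  rcases P1Q.infty_or_ofRat x with rfl | ⟨r, rfl⟩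
  · rw [potOf_infty, Rat.den_zero]; exact fun h ↦ hp.out.one_lt.ne' (Nat.dvd_one.mp h)
  · rw [potOf_ofRat]; exact hint r

omit [NeZero N] in
/-- The reduced minus symbol on the rational potentials. [folklore] -/
theorem potSymbOf_redMinus_apply (x y : P1Q) (i : Fin 1) :
    potSymbOf (fun r ↦ ι ((ratMinusSymbol f r : ℚ) : ZMod p)) x y i =
      ι ((potOf (ratMinusSymbol f) y : ℚ) : ZMod p) - ι ((potOf (ratMinusSymbol f) x : ℚ) : ZMod p) := by
  have h0 : (fun q : ℚ ↦ ι ((q : ℚ) : ZMod p)) 0 = 0 := by simp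
  rw [potSymbOf_apply, potOf_map (fun q : ℚ ↦ ι ((q : ℚ) : ZMod p)) h0,
    potOf_map (fun q : ℚ ↦ ι ((q : ℚ) : ZMod p)) h0]

/-- **`f`'s REDUCED MINUS SYMBOL LIES IN THE `θ̄_f`-EIGEN MINUS SUBSPACE** (rational newform, `Ω⁻_f ≠ 0`,
integer eigenvalues `θ`, every `[r]⁻_f` `p`-integral): from §1 and genuine reduction of the
`p`-integral values. [cite: MazurTateTeitelbaum1986Invent, §I.4 (4.2) and §I.8] -/
theorem isEigenMinusSymb_redMinusSymb (hf : IsNewform0 f) (hQ : coeffField f = ⊥)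
    (hΩ : minusPeriod f ≠ 0) (hint : ∀ r : ℚ, ¬ p ∣ (ratMinusSymbol f r).den)
    (θ : ℕ → ℤ) (hθ : ∀ q : ℕ, q.Prime → ((θ q : ℤ) : ℂ) = cuspCoeff f q) :
    IsEigenMinusSymb k N (fun q ↦ ι ((θ q : ℤ) : ZMod p))
      (potSymbOf fun r ↦ ι ((ratMinusSymbol f r : ℚ) : ZMod p)) := by
  have hS := potSymbOf_ratMinusSymbol_mem_Symb f hf hQ hΩ
  have hx := not_dvd_den_potOf_minus (f := f) hint
  refine ⟨⟨fun x y z ↦ ?_, fun γ hγ ↦ ?_⟩, fun q _ hq ↦ ?_, ?_⟩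
  · funext i
    simp only [Pi.add_apply, potSymbOf_redMinus_apply]
    ring
  · funext x y i
    rw [symPowOn_zero_slash]
    have h := congrFun (congrFun (congrFun (hS.2 γ hγ) x) y) i
    rw [symPowOn_zero_slash, potSymbOf_apply, potSymbOf_apply] at h
    rw [potSymbOf_redMinus_apply, potSymbOf_redMinus_apply, ← map_sub, ← map_sub,
      ← ratCast_sub_of_not_dvdM (hx _) (hx _), ← ratCast_sub_of_not_dvdM (hx _) (hx _), h]
  · haveI : Fact q.Prime := ⟨hq⟩
    have hH := hecke_potSymbOf_ratMinusSymbol f hf hQ hΩ (q := q) (aq := (θ q : ℚ))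
      (by rw [Rat.cast_intCast]; exact hθ q hq)
    funext x y i
    have h := congrFun (congrFun (congrFun hH x) y) i
    rw [CoeffActionOn.hecke_apply, Finset.sum_apply, Finset.sum_apply, Finset.sum_apply] at h ⊢
    simp only [symPowOn_zero_slash, potSymbOf_apply, Pi.smul_apply, smul_eq_mul] at h
    simp only [symPowOn_zero_slash]
    have hterm : ∀ j : HeckeIdx N q, potSymbOf (fun r ↦ ι ((ratMinusSymbol f r : ℚ) : ZMod p))
        (P1Q.act (heckeRep q j.1) x) (P1Q.act (heckeRep q j.1) y) i =
        ι (((potOf (ratMinusSymbol f) (P1Q.act (heckeRep q j.1) y) -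
          potOf (ratMinusSymbol f) (P1Q.act (heckeRep q j.1) x) : ℚ) : ZMod p)) := fun j ↦ by
      rw [potSymbOf_redMinus_apply, ← map_sub, ← ratCast_sub_of_not_dvdM (hx _) (hx _)]
    rw [Finset.sum_congr rfl fun j _ ↦ hterm j, ← map_sum,
      ← ratCast_sum_of_not_dvdM _ _ fun j _ ↦ not_dvd_den_subM (hx _) (hx _), h,
      ratCast_intCast_mul_of_not_dvdM _ (not_dvd_den_subM (hx y) (hx x)), map_mul,
      ratCast_sub_of_not_dvdM (hx y) (hx x), map_sub]
    simp only [Pi.smul_apply, smul_eq_mul, potSymbOf_redMinus_apply]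
  · funext x y i
    rw [symPowOn_zero_slash, Pi.neg_apply, Pi.neg_apply, Pi.neg_apply, potSymbOf_redMinus_apply,
      potSymbOf_redMinus_apply, potOf_ratMinusSymbol_act_iotaMat, potOf_ratMinusSymbol_act_iotaMat,
      Rat.cast_neg, Rat.cast_neg, map_neg, map_neg]
    ring

/-- A Hecke relation survives multiplication of the function by a constant. [folklore] -/
private theorem heckeRel_const_mulM {R : Type*} [CommRing R] {ν : ℚ → R} {q : ℕ} {a : R}
    (h : HeckeRel ν q a) (c : R) : HeckeRel (fun r ↦ c * ν r) q a := fun r ↦ by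
  have := congrArg (fun x ↦ c * x) (h r)
  simp only [mul_add, Finset.mul_sum] at this ⊢
  rw [this]; ring

/-- **`[r]⁻_f ≡ c·(μ(r) − w·μ(ℓ r))` in `k` from (MO⁻) + (OLD⁻).** [cite: Ribet1990, Thm. 1.1 and Thm. 5.2 (b)]
[cite: MazurTateTeitelbaum1986Invent, §I.8] -/
theorem exists_ratMinusSymbol_eq_mul_oldShape_of_multiplicityOneMinus (hf : IsNewform0 f)
    (hQ : coeffField f = ⊥) (hΩ : minusPeriod f ≠ 0) (hint : ∀ r : ℚ, ¬ p ∣ (ratMinusSymbol f r).den)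
    (θ : ℕ → ℤ) (hθ : ∀ q : ℕ, q.Prime → ((θ q : ℤ) : ℂ) = cuspCoeff f q)
    (hMO : ModPMultiplicityOneMinus k N (fun q ↦ ι ((θ q : ℤ) : ZMod p)))
    {ℓ : ℕ} {w : k} {μ : ℚ → k}
    (hOLD : HasOldEigenMinusSymb k N (fun q ↦ ι ((θ q : ℤ) : ZMod p)) ℓ w μ) :
    ∃ c : k, ∀ r : ℚ, ι ((ratMinusSymbol f r : ℚ) : ZMod p) = c * (μ r - w * μ (ℓ * r)) := by
  obtain ⟨c, hc⟩ := hMO _ _ (isEigenMinusSymb_redMinusSymb (ι := ι) hf hQ hΩ hint θ hθ) hOLD.1 hOLD.2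
  refine ⟨c, fun r ↦ ?_⟩
  have h := congrFun (congrFun (congrFun hc P1Q.infty) (P1Q.ofRat r)) 0
  rw [Pi.smul_apply, Pi.smul_apply, Pi.smul_apply, smul_eq_mul, potSymbOf_infty_ofRat,
    potSymbOf_infty_ofRat] at h
  exact h

/-- **The `V`-side MINUS old shape for the twist transport, from (MO⁻) + (OLD⁻) on the twist** (odd
`χ_D`, `D < 0`): `ι([r]⁻_{f} mod p) = μ'(r) − w·μ'(ℓ r)` with `μ' = c·μ` periodic and `T_q`-eigen — the
hypothesis `hV` of `plusSymbolLevelLowersOver_of_jacobiTwistFn` with `Φ = ratMinusSymbol f`.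
[cite: Ribet1990, Thm. 1.1 and Thm. 5.2 (b)] [cite: Kim2022StructureSelmer, §1.2.2 and §1.4.3] -/
theorem exists_oldShapeMinus_of_multiplicityOne_twist (hf : IsNewform0 f) (hQ : coeffField f = ⊥)
    (hΩ : minusPeriod f ≠ 0) (hint : ∀ r : ℚ, ¬ p ∣ (ratMinusSymbol f r).den)
    (θ : ℕ → ℤ) (hθ : ∀ q : ℕ, q.Prime → ((θ q : ℤ) : ℂ) = cuspCoeff f q)
    (hMO : ModPMultiplicityOneMinus k N (fun q ↦ ι ((θ q : ℤ) : ZMod p)))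
    {ℓ : ℕ} {w : k} {μ : ℚ → k}
    (hOLD : HasOldEigenMinusSymb k N (fun q ↦ ι ((θ q : ℤ) : ZMod p)) ℓ w μ) (hμ : IsPeriodic μ)
    {P : ℕ → Prop} (hH : ∀ q : ℕ, P q → HeckeRel μ q (ι ((θ q : ℤ) : ZMod p))) :
    ∃ μ' : ℚ → k, IsPeriodic μ' ∧ (∀ q : ℕ, P q → HeckeRel μ' q (ι ((θ q : ℤ) : ZMod p))) ∧
      ∀ r : ℚ, ι ((ratMinusSymbol f r : ℚ) : ZMod p) = μ' r - w * μ' (ℓ * r) := by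
  obtain ⟨c, hc⟩ :=
    exists_ratMinusSymbol_eq_mul_oldShape_of_multiplicityOneMinus hf hQ hΩ hint θ hθ hMO hOLD
  refine ⟨fun r ↦ c * μ r, fun r z ↦ by simp only [hμ r z], fun q hq ↦ heckeRel_const_mulM (hH q hq) c,
    fun r ↦ ?_⟩
  rw [hc r]
  ring

end Reduction

end Summit.BirchSwinnertonDyer.Rank1Residual.LevelLowering

end
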